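import Summits.ABC.IUTFork.Cor312LicenceBallPairs
import Summits.ABC.IUTFork.Cor312LicenceBallMixedSummand
import HarnessLib

/-!
# [IUTchIII] Cor. 3.12 — the EXACT (xi-f) criterion at a prime whose fibre consists of BALL places of ARBITRARY indices: the inclusion
# at `(j, p)` — and the licence at such data — hold **iff** the PAIR CONDITION holds at every pair of places `(w, y)` over `p`

PROOF-ONLY support piece (D-0012; 0 definitions, 0 `Prop` facts) of the abc-iut cell (prover abc-iut-w4-d006, gen 6; D-0079 R-W
«WINDOW Θ-SIDE INEQUALITY», row «W:T1½-PAIRS BALL-FIBRES lane=U», part 3 of 3 = the closing `↔`). TAKES NO SIDE on [IUTchIII] Cor. 3.12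
(S. Mochizuki, *Inter-universal Teichmüller theory III*, kurims manuscript, Cor. 3.12 p. 173 l. 41 – p. 174 l. 19; Step (xi-f) p. 184
l. 26–29; Thm. 3.11 (i) p. 154) or on any author: statements about OUR typed objects (abc-iut-c312-5's `logShellsDH`, abc-iut-c312-3's /
abc-iut-c312-7's sharp real settings `settingDHVolSharp` / `settingPrVolSharp`, Dupuy–Hilado's typed (Ind1)/(Ind2)); the hull-level licence
(`Thm311ToCor312.Licence`) is a STRONGER-THAN-PRINT form of the disputed step; nothing here bears on the printed GLOBAL inequality.
typed ≠ proved; instantiated ≠ endorsed.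

THE CRITERION. At a prime `p > 2` all of whose places `x | p` are BALL places (`log_p(𝒪_x^×) = {‖y‖ ≤ ‖ϖ_x‖}` for a uniformizer `ϖ_x`;
indices `e_x = e(x|p)` ARBITRARY and possibly different — D-0079 R-W strata U1 (`e_x ≤ p − 2`, abc-iut-w5-d180
`logUnits_eq_closedBall_of_tame`) and U1½ (`e_x = p − 1`, `ζ_p ∉ K_x`, abc-iut-w6-d060 `TorsionFree.logUnits_eq_closedBall_of_le_pred`),
mixed freely inside one fibre), label `j = i+1`, `‖t_{Θ,j,x}‖ = ‖ϖ_x‖^{m_Θ(x)}`, `‖t_{q,x}‖ = ‖ϖ_x‖^{m_q(x)}`, `D_x := (m_Θ(x) − 1) div e_x`: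

  `q-region at (j,p) ⊆ ⁿ˒°𝒰_{j,p}   ↔   ∀ w, y | p:  e_y·(e_w·min(D_w, D_y) + 1) ≤ e_y·m_q(w) + j·e_w·(e_y − 1)`.

(←) part 1 `qRegion_subset_thetaHull_settingDHVolSharp_of_ball_pairs` (p456331; (Ind1)-permuted movers over abc-iut-D1-prv's ball supplies);
(→) part 2 `not_qRegion_subset_thetaHull_settingDHVolSharp_of_two_places_ball` (the orbit lattice at the mixed summand `(y,…,y,w)`, BOTH radii
exact). The SAME integer predicate as gen 5's tame `…_iff_of_tame_pairs` (p451223); the pair `y = w` is abc-iut-D1-prv's uniform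
`…_iff_of_ball_orders` (p456193); pairs `y ≠ w` bite exactly at NON-uniform fibres (gen 5's `mixed_summand_strictly_harder_witness`); only
pairs of BAD places can fail (gen 5's `tamePair_of_min_le_neg_one`). For REALISING ideles `m_Θ(x) = j²·m_q(x)` (Dupuy–Hilado (3.4)).

WHAT IS PROVED (namespace `Summit.ABC.IUTFork.Thm311.Real`):
* **`qRegion_subset_thetaHull_settingDHVolSharp_iff_of_ball_pairs`** — the displayed `↔` at one packet.
* **`licence_settingDHVolSharp_iff_of_ball_pairs`** / **`licence_settingPrVolSharp_iff_of_ball_pairs`** — at data whose bad fibres are ball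
  fibres over odd primes (Θ-ideles units off `S`; every prime under `S` odd with all its places ball places, indices, uniformizers and
  exponents as above) the LICENCE holds iff the pair condition holds at every prime under `S`, every label and every pair of places.
HONEST SCOPE: OUR sharp containers (Θ-regions constant in `m`), Dupuy–Hilado's typed (Ind1)/(Ind2) acting independently on every
(capsule slot, place) as abc-iut-c312-1 typed Thm. 3.11 (i); refuted-as-typed ≠ refuted-in-print; nothing about the author's intended hull,
the M-level `Ism`, or the printed GLOBAL inequality; WILD places (`e_x ≥ p`, or `e_x = p − 1` with `ζ_p ∈ K_x`; stratum U2) are outside this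
file. [cite: Mochizuki2012, IUTchIV Prop. 1.1 p. 9, Prop. 1.2 (i)(ii) p. 10; IUTchIII Thm. 3.11 (i) p. 154]
[cite: DupuyHilado2025, §3.4, §3.9, §4.7, §4.9, §4.12] [cite: WeilBNT1967, Ch. II §2, Th. 1] [cite: ScholzeStix2018, §2.2 pp. 9–10]
[claim: Mochizuki2012, status: disputed].
-/

noncomputable section

open Set Metric Function
open scoped Pointwise

namespace Summit.ABC.IUTFork.Thm311.Real

open Cor312 Cor312.Setting Cor312Vol Cor312Vol.ExplicitDepth Literature.IUT.LogThetaLattice Literature.IUT.LogVolume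
  NumberField IsDedekindDomain
open Literature.NumberTheory.NumberFields Literature.NumberTheory.GaloisRepresentations.Ultrametric

variable {F : Type} [Field F] [NumberField F] (X : PilotData F) {logv : PadicLogs F} (hlog : LogvAnalytic logv)
  (M : Type) [Field M] [NumberField M]
  (archPk : ∀ (j : (thetaIndex X).Label) (vQ : (thetaIndex X).VQ), Set ((logShellsDH X logv).Packet j vQ))
  (archSub : ∀ (j : (thetaIndex X).Label) (v : (thetaIndex X).V),
    Set ((logShellsDH X logv).Packet j ((thetaIndex X).over v)))
  (Ψ : ℤ → ∀ v : (thetaIndex X).V, v ∈ (thetaIndex X).Vbad → Set ((logShellsDH X logv).StarPacket v))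
  (act : ℤ → ∀ v : (thetaIndex X).V, v ∈ (thetaIndex X).Vbad →
    (logShellsDH X logv).StarPacket v → Module.End ℚ ((logShellsDH X logv).StarPacket v))
  (Mmod : ℤ → ∀ j : (thetaIndex X).LabelStar, Set ((logShellsDH X logv).GlobalPacket j.1))
  (region : ℤ → ∀ j : (thetaIndex X).LabelStar, FinDivisor M → ∀ vQ : (thetaIndex X).VQ,
    Set ((logShellsDH X logv).Packet j.1 vQ))
  (n : ℤ) {HT : Type} {LogLink : HT → HT → Type} {IsFull : ∀ {s t : HT}, LogLink s t → Prop}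
  (lat : LGPGaussianLogThetaLattice LogLink IsFull)
  {Frd : Type} {IsoF : Frd → Frd → Type} {Ob : Frd → Type} {realify : Frd → Frd} {Strip : Type}
  {IsoS : Strip → Strip → Type} {Mv : ∀ v : (thetaIndex X).V, v ∈ (thetaIndex X).Vbad → Type}
  [∀ v h, Monoid (Mv v h)]
  (sig : GlobalLGPFrobenioidSignature (thetaIndex X).lstar (thetaIndex X).V (· ∈ (thetaIndex X).Vbad)
    Frd IsoF Ob realify Strip IsoS Mv)
  (split : SplittingMonoids Mv) {ObΔ : Type} {N : ∀ v : (thetaIndex X).V, v ∈ (thetaIndex X).Vbad → Type}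
  [∀ v h, Monoid (N v h)] (qData : QPilotData ObΔ N)
  (tq : ∀ (pp : Nat.Primes) (x : (thetaIndex X).Fibre (.inr pp)), haveI : Fact (pp : ℕ).Prime := ⟨pp.2⟩; kOf X pp.1 x)
  (t : ∀ (pp : Nat.Primes) (_ : Fin X.lstar) (x : (thetaIndex X).Fibre (.inr pp)),
    haveI : Fact (pp : ℕ).Prime := ⟨pp.2⟩; kOf X pp.1 x)
  (htq0 : ∀ pp x, tq pp x ≠ 0)
  (htq1 : ∀ (pp : Nat.Primes) (x : (thetaIndex X).Fibre (.inr pp)),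
    haveI : Fact (pp : ℕ).Prime := ⟨pp.2⟩; placeOf X pp.1 x ∉ X.S → ‖tq pp x‖ = 1)

/-! ## 1. One packet -/

/-- **THE (xi-f) INCLUSION AT ONE PACKET OVER A BALL FIBRE OF ARBITRARY INDICES IS DECIDED BY THE PAIR CONDITION.** `p > 2`; every
place `x | p` a ball place (`log_p(𝒪_x^×) = {‖y‖ ≤ ‖ϖ_x‖}`, `ϖ_x` a uniformizer) with index `e_x` (the `e_x` may differ); `j = i+1`;
`‖t_{Θ,j,x}‖ = ‖ϖ_x‖^{m_Θ(x)}`, `‖t_{q,x}‖ = ‖ϖ_x‖^{m_q(x)}`; `D_x = (m_Θ(x) − 1) div e_x`. Then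
`q-region at (j,p) ⊆ ⁿ˒°𝒰_{j,p} ↔ ∀ w y, e_y·(e_w·min(D_w, D_y) + 1) ≤ e_y·m_q(w) + j·e_w·(e_y − 1)`.
[cite: Mochizuki2012, IUTchIV Prop. 1.1 p. 9, Prop. 1.2 (i)(ii) p. 10; IUTchIII Thm. 3.11 (i) p. 154] [cite: DupuyHilado2025, §3.9, §4.7, §4.9, §4.12]
[claim: Mochizuki2012, status: disputed] -/
theorem qRegion_subset_thetaHull_settingDHVolSharp_iff_of_ball_pairs (i : Fin (thetaIndex X).lstar) (pp : Nat.Primes)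
    (hp2 : 2 < (pp : ℕ)) (E : (thetaIndex X).Fibre (.inr pp) → ℕ)
    (ϖ : haveI : Fact (pp : ℕ).Prime := ⟨pp.2⟩; ∀ x : (thetaIndex X).Fibre (.inr pp), (kOf X pp.1 x)ˣ)
    (hfib : haveI : Fact (pp : ℕ).Prime := ⟨pp.2⟩
      ∀ x : (thetaIndex X).Fibre (.inr pp),
        (placeOf X pp.1 x).asIdeal.ramificationIdx ℤ = E x ∧ IsUniformizer (ϖ x) ∧
          logUnits (kOf X pp.1 x) = closedBall (0 : kOf X pp.1 x) ‖(ϖ x : kOf X pp.1 x)‖)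
    (mΘ mq : (thetaIndex X).Fibre (.inr pp) → ℤ)
    (hΘ : haveI : Fact (pp : ℕ).Prime := ⟨pp.2⟩
      ∀ x : (thetaIndex X).Fibre (.inr pp), ‖t pp i x‖ = ‖(ϖ x : kOf X pp.1 x)‖ ^ mΘ x)
    (hq : haveI : Fact (pp : ℕ).Prime := ⟨pp.2⟩
      ∀ x : (thetaIndex X).Fibre (.inr pp), ‖tq pp x‖ = ‖(ϖ x : kOf X pp.1 x)‖ ^ mq x) :
    (settingDHVolSharp X hlog M archPk archSub Ψ act Mmod region n lat sig split qData tq t htq0 htq1).qRegion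
        (labelSucc i) (.inr pp) ⊆
      (settingDHVolSharp X hlog M archPk archSub Ψ act Mmod region n lat sig split qData tq t htq0 htq1).thetaHull
        (labelSucc i) (.inr pp) ↔
    ∀ w y : (thetaIndex X).Fibre (.inr pp),
      (E y : ℤ) * ((E w : ℤ) * min ((mΘ w - 1) / (E w : ℤ)) ((mΘ y - 1) / (E y : ℤ)) + 1) ≤
        (E y : ℤ) * mq w + ((i : ℕ) + 1 : ℕ) * (E w : ℤ) * ((E y : ℤ) - 1) := by
  haveI hF : Fact (pp : ℕ).Prime := ⟨pp.2⟩
  constructor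
  · -- (→): a violated pair `(w, y)` refutes the inclusion at the mixed summand `(y, …, y, w)`
    intro hincl w y
    by_contra hlt
    rw [not_le] at hlt
    have heK : ∀ x : (thetaIndex X).Fibre (.inr pp), absRamificationIdx (pp : ℕ) (kOf X pp.1 x) = E x := fun x =>
      (absRamificationIdx_rescaledCompletion F (pp : ℕ) (placeOf X pp.1 x) (natCast_mem_placeOf X pp.1 x)).trans (hfib x).1
    refine not_qRegion_subset_thetaHull_settingDHVolSharp_of_two_places_ball X hlog M archPk archSub Ψ act Mmod region n lat sig split
      qData tq t htq0 htq1 pp i y w hp2 ϖ ⟨(hfib y).2.1, (hfib y).2.2⟩ ⟨(hfib w).2.1, (hfib w).2.2⟩ mΘ (mq w) (hΘ y) (hΘ w) (hq w)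
      ?_ hincl
    rw [heK y, heK w]
    push_cast at hlt ⊢
    linarith
  · -- (←): the permuted movers over the ball supplies (part 1)
    exact qRegion_subset_thetaHull_settingDHVolSharp_of_ball_pairs X hlog M archPk archSub Ψ act Mmod region n lat sig split qData tq
      t htq0 htq1 i pp E ϖ hfib mΘ mq hΘ hq

/-! ## 2. The licence at data whose bad fibres are ball fibres over odd primes -/

/-- **THE (xi-f) LICENCE AT `settingDHVolSharp` IS DECIDED AT DATA WHOSE BAD FIBRES ARE BALL FIBRES (arbitrary indices).** Θ-ideles
units off `S`; at every prime `p` UNDER `S`: `p > 2`, every place `x | p` a ball place with index `e_{p,x}` and uniformizer `ϖ_{p,x}`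
(`log_p(𝒪_x^×) = {‖y‖ ≤ ‖ϖ_{p,x}‖}`), exponents `‖t_{Θ,j,x}‖ = ‖ϖ‖^{m_Θ(p,j,x)}`, `‖t_{q,x}‖ = ‖ϖ‖^{m_q(p,x)}` at EVERY place over `p` (`0` at
the good ones). THEN `Thm311ToCor312.Licence` holds **iff** at every prime under `S`, every label `j = i+1` and every pair `(w, y)` of places
over `p`: `e_y·(e_w·min(D_w, D_y) + 1) ≤ e_y·m_q(w) + j·e_w·(e_y − 1)` (`D_x = (m_Θ(p,j,x) − 1) div e_{p,x}`). The one-index restriction of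
abc-iut-D1-prv's `licence_settingDHVolSharp_iff_of_ball_orders` (p456193) is gone; at tame fibres this is gen 5's p451223.
[cite: Mochizuki2012, IUTchIV Prop. 1.1 p. 9, Prop. 1.2 (i)(ii) p. 10; IUTchIII Thm. 3.11 (i) p. 154] [cite: DupuyHilado2025, §3.4, §3.9, §4.7, §4.9]
[claim: Mochizuki2012, status: disputed] -/
theorem licence_settingDHVolSharp_iff_of_ball_pairs
    (ht1 : ∀ (pp : Nat.Primes) (i : Fin X.lstar) (x : (thetaIndex X).Fibre (.inr pp)),
      haveI : Fact (pp : ℕ).Prime := ⟨pp.2⟩; placeOf X pp.1 x ∉ X.S → ‖t pp i x‖ = 1)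
    (E : ∀ pp : Nat.Primes, (thetaIndex X).Fibre (.inr pp) → ℕ)
    (ϖ : ∀ (pp : Nat.Primes) (x : (thetaIndex X).Fibre (.inr pp)), haveI : Fact (pp : ℕ).Prime := ⟨pp.2⟩; (kOf X pp.1 x)ˣ)
    (hfib : ∀ (pp : Nat.Primes) (x : (thetaIndex X).Fibre (.inr pp)),
      haveI : Fact (pp : ℕ).Prime := ⟨pp.2⟩
      (∃ w : (thetaIndex X).Fibre (.inr pp), placeOf X pp.1 w ∈ X.S) →
        2 < (pp : ℕ) ∧ (placeOf X pp.1 x).asIdeal.ramificationIdx ℤ = E pp x ∧ IsUniformizer (ϖ pp x) ∧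
          logUnits (kOf X pp.1 x) = closedBall (0 : kOf X pp.1 x) ‖(ϖ pp x : kOf X pp.1 x)‖)
    (mΘ : ∀ pp : Nat.Primes, Fin (thetaIndex X).lstar → (thetaIndex X).Fibre (.inr pp) → ℤ)
    (mq : ∀ pp : Nat.Primes, (thetaIndex X).Fibre (.inr pp) → ℤ)
    (hΘ : ∀ (pp : Nat.Primes) (i : Fin (thetaIndex X).lstar) (x : (thetaIndex X).Fibre (.inr pp)),
      haveI : Fact (pp : ℕ).Prime := ⟨pp.2⟩
      (∃ w : (thetaIndex X).Fibre (.inr pp), placeOf X pp.1 w ∈ X.S) → ‖t pp i x‖ = ‖(ϖ pp x : kOf X pp.1 x)‖ ^ mΘ pp i x)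
    (hq : ∀ (pp : Nat.Primes) (x : (thetaIndex X).Fibre (.inr pp)),
      haveI : Fact (pp : ℕ).Prime := ⟨pp.2⟩
      (∃ w : (thetaIndex X).Fibre (.inr pp), placeOf X pp.1 w ∈ X.S) → ‖tq pp x‖ = ‖(ϖ pp x : kOf X pp.1 x)‖ ^ mq pp x) :
    Thm311ToCor312.Licence (settingDHVolSharp X hlog M archPk archSub Ψ act Mmod region n lat sig split qData tq t htq0 htq1) ↔
      ∀ (pp : Nat.Primes) (i : Fin (thetaIndex X).lstar),
        haveI : Fact (pp : ℕ).Prime := ⟨pp.2⟩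
        (∃ w : (thetaIndex X).Fibre (.inr pp), placeOf X pp.1 w ∈ X.S) →
          ∀ w y : (thetaIndex X).Fibre (.inr pp),
            (E pp y : ℤ) * ((E pp w : ℤ) * min ((mΘ pp i w - 1) / (E pp w : ℤ)) ((mΘ pp i y - 1) / (E pp y : ℤ)) + 1) ≤
              (E pp y : ℤ) * mq pp w + ((i : ℕ) + 1 : ℕ) * (E pp w : ℤ) * ((E pp y : ℤ) - 1) := by
  constructor
  · intro hL pp i hS
    haveI : Fact (pp : ℕ).Prime := ⟨pp.2⟩
    have hp2 : 2 < (pp : ℕ) := (hfib pp (Classical.choose hS) hS).1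
    exact (qRegion_subset_thetaHull_settingDHVolSharp_iff_of_ball_pairs X hlog M archPk archSub Ψ act Mmod region n lat sig split qData
      tq t htq0 htq1 i pp hp2 (E pp) (ϖ pp) (fun x => (hfib pp x hS).2) (mΘ pp i) (mq pp) (fun x => hΘ pp i x hS)
      (fun x => hq pp x hS)).1 (hL i (.inr pp))
  · intro hall i vQ
    cases vQ with
    | inl u =>
      exact qRegion_subset_thetaHull_settingDHVolSharp_inl X hlog M archPk archSub Ψ act Mmod region n lat sig split qData tq t htq0
        htq1 (labelSucc i) u
    | inr pp =>
      haveI : Fact (pp : ℕ).Prime := ⟨pp.2⟩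
      by_cases hS : ∃ w : (thetaIndex X).Fibre (.inr pp), placeOf X pp.1 w ∈ X.S
      · have hp2 : 2 < (pp : ℕ) := (hfib pp (Classical.choose hS) hS).1
        exact (qRegion_subset_thetaHull_settingDHVolSharp_iff_of_ball_pairs X hlog M archPk archSub Ψ act Mmod region n lat sig split
          qData tq t htq0 htq1 i pp hp2 (E pp) (ϖ pp) (fun x => (hfib pp x hS).2) (mΘ pp i) (mq pp) (fun x => hΘ pp i x hS)
          (fun x => hq pp x hS)).2 (hall pp i hS)
      · exact qRegion_subset_thetaHull_settingDHVolSharp_of_forall_not_mem X hlog M archPk archSub Ψ act Mmod region n lat sig split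
          qData tq t htq0 htq1 i pp ht1 fun w hw => hS ⟨w, hw⟩

/-- **The same at the PRINT-NORMALISED setting `settingPrVolSharp`** (branch C's setting; `licence_settingPrVolSharp_iff_settingDHVolSharp`).
[cite: DupuyHilado2025, §3.9, §4.9] [claim: Mochizuki2012, status: disputed] -/
theorem licence_settingPrVolSharp_iff_of_ball_pairs
    (ht1 : ∀ (pp : Nat.Primes) (i : Fin X.lstar) (x : (thetaIndex X).Fibre (.inr pp)),
      haveI : Fact (pp : ℕ).Prime := ⟨pp.2⟩; placeOf X pp.1 x ∉ X.S → ‖t pp i x‖ = 1)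
    (E : ∀ pp : Nat.Primes, (thetaIndex X).Fibre (.inr pp) → ℕ)
    (ϖ : ∀ (pp : Nat.Primes) (x : (thetaIndex X).Fibre (.inr pp)), haveI : Fact (pp : ℕ).Prime := ⟨pp.2⟩; (kOf X pp.1 x)ˣ)
    (hfib : ∀ (pp : Nat.Primes) (x : (thetaIndex X).Fibre (.inr pp)),
      haveI : Fact (pp : ℕ).Prime := ⟨pp.2⟩
      (∃ w : (thetaIndex X).Fibre (.inr pp), placeOf X pp.1 w ∈ X.S) →
        2 < (pp : ℕ) ∧ (placeOf X pp.1 x).asIdeal.ramificationIdx ℤ = E pp x ∧ IsUniformizer (ϖ pp x) ∧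
          logUnits (kOf X pp.1 x) = closedBall (0 : kOf X pp.1 x) ‖(ϖ pp x : kOf X pp.1 x)‖)
    (mΘ : ∀ pp : Nat.Primes, Fin (thetaIndex X).lstar → (thetaIndex X).Fibre (.inr pp) → ℤ)
    (mq : ∀ pp : Nat.Primes, (thetaIndex X).Fibre (.inr pp) → ℤ)
    (hΘ : ∀ (pp : Nat.Primes) (i : Fin (thetaIndex X).lstar) (x : (thetaIndex X).Fibre (.inr pp)),
      haveI : Fact (pp : ℕ).Prime := ⟨pp.2⟩
      (∃ w : (thetaIndex X).Fibre (.inr pp), placeOf X pp.1 w ∈ X.S) → ‖t pp i x‖ = ‖(ϖ pp x : kOf X pp.1 x)‖ ^ mΘ pp i x)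
    (hq : ∀ (pp : Nat.Primes) (x : (thetaIndex X).Fibre (.inr pp)),
      haveI : Fact (pp : ℕ).Prime := ⟨pp.2⟩
      (∃ w : (thetaIndex X).Fibre (.inr pp), placeOf X pp.1 w ∈ X.S) → ‖tq pp x‖ = ‖(ϖ pp x : kOf X pp.1 x)‖ ^ mq pp x) :
    Thm311ToCor312.Licence (settingPrVolSharp X hlog M archPk archSub Ψ act Mmod region n lat sig split qData tq t htq0 htq1) ↔
      ∀ (pp : Nat.Primes) (i : Fin (thetaIndex X).lstar),
        haveI : Fact (pp : ℕ).Prime := ⟨pp.2⟩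
        (∃ w : (thetaIndex X).Fibre (.inr pp), placeOf X pp.1 w ∈ X.S) →
          ∀ w y : (thetaIndex X).Fibre (.inr pp),
            (E pp y : ℤ) * ((E pp w : ℤ) * min ((mΘ pp i w - 1) / (E pp w : ℤ)) ((mΘ pp i y - 1) / (E pp y : ℤ)) + 1) ≤
              (E pp y : ℤ) * mq pp w + ((i : ℕ) + 1 : ℕ) * (E pp w : ℤ) * ((E pp y : ℤ) - 1) := by
  rw [licence_settingPrVolSharp_iff_settingDHVolSharp]
  exact licence_settingDHVolSharp_iff_of_ball_pairs X hlog M archPk archSub Ψ act Mmod region n lat sig split qData tq t htq0 htq1 ht1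
    E ϖ hfib mΘ mq hΘ hq


end Summit.ABC.IUTFork.Thm311.Real

end
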